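import Summits.QuantumFields.YangMills.Theorems.ColdStartUniversalityLatticeLangevinLocalPoincare
import Summits.QuantumFields.YangMills.Theorems.ColdStartUniversalityLatticeLangevinPlaquetteVariance
import Summits.QuantumFields.YangMills.Theorems.ColdStartUniversalityUniformColdStartMixingFixedCutoffEquilibriumWindow
import HarnessLib

/-!
# Route `ColdStartUniversality` (fixed-cut-off package, Bakry–Émery side, GRADIENT half): DYNAMIC CONCENTRATION OF THE ACTION DENSITY —
# `Var(S_W(U_t)/#𝒫) ≤ 32/((1 − 12|β'|)·#𝒫)` along EVERY SZZ solution from a deterministic start, at EVERY time, for EVERY volume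

Helper file (seat `ym-line-csu-p1`, g29; `--supports stmt-QuantumFields-24809`).  Concrete, planner-facing instance of the dynamic variance bound
`wilson_solution_variance_le_uniform` (local Poincaré inequality for the SZZ semigroup, g29) with g27's carré bound for the plaquette function
(`wilson_plaquette_carre_le`: `Γ^A(S_W/#𝒫) ≤ 64/#𝒫`):
* ★★★ `wilson_solution_actionDensity_variance_le_uniform` — for every torus size `L`, `|β'| < 1/12`, every filtered probability space with a
  flat Brownian driver, every strong solution `U` of the SU(2) SZZ Langevin SDE with deterministic start `U_0 ≡ x₀` (e.g. the COLD START
  `x₀ = 1`) and every lattice time `t`:  `∫ (S_W(U_t)/#𝒫 − E[S_W(U_t)/#𝒫])² dP ≤ 32/((1 − 12|β'|)·#𝒫)`, `#𝒫 = 3L³` — the same CLT-scale bound as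
  for the EQUILIBRIUM state (`wilson_actionDensity_variance_uniform`, g27), now at all times along the non-stationary evolution;
* ★★ `actionDensity_dynamicVariance_fixedCutoff_window` — the same at the route's cut-off coupling `β'_K = (γε_K)⁻¹/2` in the window
  `γε_K > 6` (`1 − 12|β'_K| = 1 − 6/(γε_K)`, `#𝒫 = 3L_K³`, `L_K = (F.P K).sitesPerDir 0`), for every cold/deterministic-start solution on the
  `K`-th lattice.
THEOREMS ONLY, no definition, no sorry.  PLANNER-FACING, HONEST: fixed cut-off; the window `γε_K > 6` contains only the coarse cut-offs; nothing
K-uniform; 24809 is ASIDE and NOT restated; no crux, rung or summit statement is proved; the Yang–Mills mass gap is NOT proved.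
-/

set_option autoImplicit false

noncomputable section

namespace Summit.QuantumFields.YangMills.Theorems.ColdStartUniversality

open MeasureTheory ProbabilityTheory Matrix Complex Finset Filter Set Metric
open scoped ComplexConjugate BigOperators Matrix NNReal ENNReal Topology
open Literature.Probability.Process Literature.MathematicalPhysics.QuantumFieldTheory
open Literature.MathematicalPhysics.QuantumFieldTheory.Balaban1983to89
open Literature.MathematicalPhysics.QuantumLattice (fundamentalRep fundamentalLatticeRep continuous_fundamentalRep fundamentalRep_apply)

variable {L : ℕ} [NeZero L]

/-- ★★★ **Dynamic concentration of the action density along every SZZ solution, uniform in time and volume.**  For every `L`,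
`|β'| < 1/12`, every strong solution `U` of the SU(2) lattice Langevin SDE from a deterministic start and every lattice time `t`:
`∫ (S_W(U_t)/#𝒫 − E[S_W(U_t)/#𝒫])² dP ≤ 32 / ((1 − 12|β'|)·#𝒫)`. [cite: BakryGentilLedoux2014, Thm 4.7.2 (ii); ShenZhuZhu2022 §4 Cor. 4.8] -/
theorem wilson_solution_actionDensity_variance_le_uniform (L : ℕ) [NeZero L] (β' : ℝ) (hβ : |β'| < 1 / 12) (t : ℝ≥0) (x₀ : (GaugeConfig 3 L (Matrix.specialUnitaryGroup (Fin 2) ℂ)))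
    (Ω : Type) [MeasurableSpace Ω] (P : Measure Ω) [IsProbabilityMeasure P]
    (W : ℝ≥0 → Ω → (Edge 3 L × NoiseIdx 2 → ℝ)) (hW : IsFlatBrownian W P)
    (U : ℝ≥0 → Ω → (GaugeConfig 3 L (Matrix.specialUnitaryGroup (Fin 2) ℂ))) (hU0 : ∀ ω, U 0 ω = x₀)
    (hU : (latticeLangevinDynamics (fundamentalLatticeRep 2) β').IsSolution (fundamentalRep (Fin 2)) hW.natFiltration P W U) :
    ∫ ω, (wilsonAction (fundamentalRep (Fin 2)) (U t ω) / (Fintype.card (Plaquette 3 L) : ℝ) -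
        ∫ ω', wilsonAction (fundamentalRep (Fin 2)) (U t ω') / (Fintype.card (Plaquette 3 L) : ℝ) ∂P) ^ 2 ∂P ≤
      32 / ((1 - 12 * |β'|) * (Fintype.card (Plaquette 3 L) : ℝ)) := by
  classical
  haveI := secondCountableTopology_su2
  haveI := borelSpace_config L
  have hρ : 0 < 1 - 12 * |β'| := by linarith
  set nP : ℝ := (Fintype.card (Plaquette 3 L) : ℝ) with hnP
  have hnPpos : 0 < nP := card_plaquette_three_pos L
  set b : ℝ := nP⁻¹ with hb
  set co : (GaugeConfig 3 L (Matrix.specialUnitaryGroup (Fin 2) ℂ)) → (Edge 3 L × Fin 2 × Fin 2 × Bool → ℝ) := (fun (V : GaugeConfig 3 L (Matrix.specialUnitaryGroup (Fin 2) ℂ)) (q : Edge 3 L × Fin (fundamentalLatticeRep 2).N × Fin (fundamentalLatticeRep 2).N × Bool) => (fun z : ℂ => if q.2.2.2 then z.im else z.re) ((fundamentalRep (Fin 2) (V q.1) : Matrix (Fin 2) (Fin 2) ℂ) q.2.1 q.2.2.1)) with hco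
  set fp : (Edge 3 L × Fin 2 × Fin 2 × Bool → ℝ) → ℝ := (fun y : (Edge 3 L × Fin 2 × Fin 2 × Bool → ℝ) => b * ∑ p : Plaquette 3 L, (rootedLoop (fun (ee : Edge 3 L) (i j : Fin 2) => ((y (ee, i, j, false) : ℝ) : ℂ) + ((y (ee, i, j, true) : ℝ) : ℂ) * Complex.I) (p.1, p.2.1.1) p.2.1.2 false).trace.re) with hfp
  have hfpC : ContDiff ℝ 5 fp := contDiff_psiHat (d := 3) (L := L) (N := 2) (n := 5) b
  have hval : ∀ V, fp (co V) = 2 - wilsonAction (fundamentalRep (Fin 2)) V / nP := by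
    intro V
    have h : fp (co V) = 2 * b * nP - b * wilsonAction (fundamentalRep (Fin 2)) V := psiHat_coords_eq_wilsonAction b V
    rw [h, div_eq_mul_inv, hb]
    have : 2 * nP⁻¹ * nP = 2 := by rw [mul_assoc, inv_mul_cancel₀ hnPpos.ne', mul_one]
    rw [this]; ring
  -- the dynamic variance bound for `fp` with `σ² = 64 b² nP`
  have h := wilson_solution_variance_le_uniform L β' hβ hfpC t x₀ Ω P W hW U hU0 hU (wilson_plaquette_carre_le L β' b)
  -- bookkeeping: `Y = fp(coords U_t) = 2 − X`
  have hmU : Measurable (U t) := (hU.adapted t).mono (hW.natFiltration.le t) le_rfl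
  have cY : Continuous fun V : (GaugeConfig 3 L (Matrix.specialUnitaryGroup (Fin 2) ℂ)) => fp (co V) := hfpC.continuous.comp (continuous_coords (L := L))
  obtain ⟨M, hM⟩ : ∃ M, ∀ V : (GaugeConfig 3 L (Matrix.specialUnitaryGroup (Fin 2) ℂ)), |fp (co V)| ≤ M := by
    obtain ⟨M, hM⟩ := isCompact_univ.exists_bound_of_continuousOn cY.continuousOn
    exact ⟨M, fun V => by simpa [Real.norm_eq_abs] using hM V (Set.mem_univ V)⟩
  have hYm : AEStronglyMeasurable (fun ω => fp (co (U t ω))) P := (cY.measurable.comp hmU).aestronglyMeasurable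
  have iY : Integrable (fun ω => fp (co (U t ω))) P :=
    Integrable.of_bound hYm M (ae_of_all _ fun ω => by rw [Real.norm_eq_abs]; exact hM _)
  have iYY : Integrable (fun ω => fp (co (U t ω)) * fp (co (U t ω))) P := by
    refine Integrable.of_bound (hYm.mul hYm) (M * M) (ae_of_all _ fun ω => ?_)
    rw [Real.norm_eq_abs, abs_mul]
    have hM0 : 0 ≤ M := (abs_nonneg _).trans (hM (U t ω))
    exact mul_le_mul (hM _) (hM _) (abs_nonneg _) hM0
  set m : ℝ := ∫ ω, fp (co (U t ω)) ∂P with hm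
  -- `∫ (Y − m)² = ∫ Y² − m²`
  have hexpand : ∫ ω, (fp (co (U t ω)) - m) ^ 2 ∂P = ∫ ω, fp (co (U t ω)) * fp (co (U t ω)) ∂P - m ^ 2 := by
    have e1 : (fun ω => (fp (co (U t ω)) - m) ^ 2) = fun ω => fp (co (U t ω)) * fp (co (U t ω)) - 2 * m * fp (co (U t ω)) + m ^ 2 := by
      funext ω; ring
    have i2 : Integrable (fun ω => 2 * m * fp (co (U t ω))) P := iY.const_mul _
    have i12 : Integrable (fun ω => fp (co (U t ω)) * fp (co (U t ω)) - 2 * m * fp (co (U t ω))) P := iYY.sub i2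
    rw [e1, integral_add i12 (integrable_const _), integral_sub iYY i2, integral_const_mul, integral_const]
    simp only [probReal_univ, smul_eq_mul, one_mul]
    rw [← hm]; ring
  -- `(X − EX)² = (Y − EY)²` pointwise
  have hX : ∀ ω, wilsonAction (fundamentalRep (Fin 2)) (U t ω) / nP = 2 - fp (co (U t ω)) := fun ω => by rw [hval]; ring
  have hEX : ∫ ω', wilsonAction (fundamentalRep (Fin 2)) (U t ω') / nP ∂P = 2 - m := by
    rw [show (fun ω' => wilsonAction (fundamentalRep (Fin 2)) (U t ω') / nP) = fun ω' => (2 : ℝ) - fp (co (U t ω')) from funext hX,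
      integral_sub (integrable_const _) iY, integral_const]
    simp only [probReal_univ, smul_eq_mul, one_mul]
    rfl
  have hsq : ∀ ω, (wilsonAction (fundamentalRep (Fin 2)) (U t ω) / nP - ∫ ω', wilsonAction (fundamentalRep (Fin 2)) (U t ω') / nP ∂P) ^ 2 =
      (fp (co (U t ω)) - m) ^ 2 := fun ω => by rw [hEX, hX]; ring
  rw [integral_congr_ae (ae_of_all _ fun ω => hsq ω), hexpand]
  have hconst : (64 * b ^ 2 * (Fintype.card (Plaquette 3 L) : ℝ)) / (2 * (1 - 12 * |β'|)) = 32 / ((1 - 12 * |β'|) * nP) := by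
    rw [hb, ← hnP]
    field_simp
    ring
  rw [← hconst]
  exact h

/-- ★★ **Dynamic concentration of the action density at the route's cut-offs, inside the window `γε_K > 6`.**  For every cut-off `K` with
`6 < γε_K`, every strong solution `U` of the SZZ SDE at `β'_K = (γε_K)⁻¹/2` on the `K`-th lattice from a deterministic start (e.g. the cold
start) and every lattice time `t`:  `∫ (S_W(U_t)/(3L_K³) − E[·])² dP ≤ 32/((1 − 6/(γε_K))·3L_K³)`. [cite: BakryGentilLedoux2014, Thm 4.7.2 (ii)] -/
theorem actionDensity_dynamicVariance_fixedCutoff_window (F : T3ContinuumYM3Torus.T3Family) (γ : ℝ) (K : ℕ) (hK : 6 < γ * (F.P K).eps)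
    (t : ℝ≥0) (x₀ : GaugeConfig 3 ((F.P K).sitesPerDir 0) (Matrix.specialUnitaryGroup (Fin 2) ℂ))
    (Ω : Type) [MeasurableSpace Ω] (P : Measure Ω) [IsProbabilityMeasure P]
    (W : ℝ≥0 → Ω → (Edge 3 ((F.P K).sitesPerDir 0) × NoiseIdx 2 → ℝ)) (hW : IsFlatBrownian W P)
    (U : ℝ≥0 → Ω → GaugeConfig 3 ((F.P K).sitesPerDir 0) (Matrix.specialUnitaryGroup (Fin 2) ℂ)) (hU0 : ∀ ω, U 0 ω = x₀)
    (hU : (latticeLangevinDynamics (fundamentalLatticeRep 2) ((γ * (F.P K).eps)⁻¹ / 2)).IsSolution (fundamentalRep (Fin 2)) hW.natFiltration P W U) :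
    ∫ ω, (wilsonAction (fundamentalRep (Fin 2)) (U t ω) / (3 * ((((F.P K).sitesPerDir 0) : ℕ) : ℝ) ^ 3) -
        ∫ ω', wilsonAction (fundamentalRep (Fin 2)) (U t ω') / (3 * ((((F.P K).sitesPerDir 0) : ℕ) : ℝ) ^ 3) ∂P) ^ 2 ∂P ≤
      32 / ((1 - 6 / (γ * (F.P K).eps)) * (3 * ((((F.P K).sitesPerDir 0) : ℕ) : ℝ) ^ 3)) := by
  obtain ⟨hβ, hrate⟩ := window_coupling_bounds F γ K hK
  have h := wilson_solution_actionDensity_variance_le_uniform ((F.P K).sitesPerDir 0) ((γ * (F.P K).eps)⁻¹ / 2) hβ t x₀ Ω P W hW U hU0 hU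
  rw [(card_site_plaquette_fixedCutoff F K).2, hrate] at h
  exact h

end Summit.QuantumFields.YangMills.Theorems.ColdStartUniversality
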